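import Literature.NumberTheory.Rogawski1990.CartanRealisation
import HarnessLib

/-!
# Realisation across an inner twist: `ᵗ(σg) H′ g = H · x` with `x ∈ Z(γ)`, `γ ∈ U(H)` ⇒ `g γ g⁻¹ ∈ U(H′)` (Rogawski 1990, §3.1 p. 19; §14.1 p. 232)

Topic `NumberTheory/Rogawski1990`; namespace `Literature.NumberTheory.Rogawski1990`; **THEOREMS ONLY** (no definition, no named fact, no instance, no
notation, no `sorry`).  Cell `pub/hodgecm-mathlib`, ENGINE T1 (crux H413 = `stmt-HodgeConjecture-24833`), row «T1b-VANISH ∕ occurrence local–global» (F0P3a-p01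
(g5)), brick (i): the TWO-FORM version of ★ `CartanRealisation.conj_mem_unitaryGroup_of_twistGram_eq_mul` (there source form = target form).  For a commutative
ring `R` with involution `σ`, forms `H` (carrying `γ ∈ U(H)(R)`) and `H′`, and `g ∈ GL_n(R)` whose transported form `H′_g = ᵗ(σg) H′ g` is the `γ`-INVARIANT
form `H · x` (`x` commuting with `γ`): the conjugate `g γ g⁻¹` lies in `U(H′)(R)` — «`γ` OCCURS in `U(H′)`» ([Rogawski1990] §14.1: «`γ` occurs in `G′` if
`γ′ ↔ γ` for some `γ′ ∈ G′`»).  Over the CM field this turns every congruence `H′ ≅ H · x` (Landherr ★ `QuadraticForms.hermitianMatrices_congruent_iff_invariants`)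
into a rational element of `U(H′)(L⁺)` in the stable class of `γ`.  HC_CM is proved only modulo the printed citations until rung 0 closes.

* `twistGram_conj_eq_of_twistGram_eq_mul` — `H′_{g γ g⁻¹ … }`: `ᵗσ(gγg⁻¹) H′ (gγg⁻¹) = H′`.
* **`conj_mem_unitaryGroup_of_twistGram_eq_mul₂`** — `g γ g⁻¹ ∈ U(H′)(R)`.
* `exists_unitary_isConj_of_twistGram_eq_mul₂` — packaged: `∃ δ ∈ U(H′)(R)` with `g γ g⁻¹ = δ`, so `γ` and `δ` are `GL_n(R)`-conjugate.
* §2 (ED. 2) the converse: `twistGram_invariant₂`, **`commute_inv_mul_twistGram₂`** ∕ `inv_mul_twistGram_mem_cartanAlgebra₂` (`g γ g⁻¹ ∈ U(H′)` ⇒ `H′_g = H · x`,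
  `x := H⁻¹ H′_g ∈ Z(γ)`), `twistGram_eq_mul_inv_mul_twistGram`.

## References
* [Rogawski1990] J. D. Rogawski, *Automorphic Representations of Unitary Groups in Three Variables*, Ann. of Math. Stud. 123 (1990), §3.1 p. 19, §14.1 p. 232.
* [Kottwitz1986] R. E. Kottwitz, *Stable trace formula: elliptic singular terms*, Math. Ann. 275 (1986), §9.
-/

set_option autoImplicit false

noncomputable section

namespace Literature.NumberTheory.Rogawski1990

open scoped MatrixGroups Matrix
open Literature.AlgebraicGeometry.ShimuraVarieties (unitaryGroup mem_unitaryGroup_iff)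

section General

variable {R : Type*} [CommRing R] {n : Type*} [Fintype n] [DecidableEq n] (σ : R →+* R) (H H' : Matrix n n R)

/-- If `H′_g = H · x` with `x` commuting with `γ ∈ U(H)(R)`, then `H′_{g γ} = H′_g` (`ᵗ(σγ) (H x) γ = ᵗ(σγ) H γ x = H x`). [cite: Rogawski1990, §3.1 p. 19] -/
theorem twistGram_mul_eq_of_twistGram_eq_mul₂ {γ : GL n R} (hγ : γ ∈ unitaryGroup σ H) {x g : Matrix n n R} (hx : Commute x (γ : Matrix n n R))
    (hgx : twistGram σ H' g = H * x) : twistGram σ H' (g * (γ : Matrix n n R)) = twistGram σ H' g := by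
  rw [twistGram_mul, hgx]
  conv_rhs => rw [← twistGram_coe_eq_of_mem_unitaryGroup σ H hγ, twistGram_def]
  simp only [Matrix.mul_assoc, hx.eq]

/-- **Realisation across an inner twist, ring form: `H′_g = H · x` with `x ∈ Z(γ)`, `γ ∈ U(H)(R)` ⇒ `g γ g⁻¹ ∈ U(H′)(R)`** — every `γ`-invariant form
congruent to `H′` makes a conjugate of `γ` preserve `H′` («`γ` occurs in `U(H′)`»). [cite: Rogawski1990, §3.1 p. 19; §14.1 p. 232] -/
theorem conj_mem_unitaryGroup_of_twistGram_eq_mul₂ {γ : GL n R} (hγ : γ ∈ unitaryGroup σ H) {x : Matrix n n R} (hx : Commute x (γ : Matrix n n R))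
    {g : GL n R} (hgx : twistGram σ H' (g : Matrix n n R) = H * x) : g * γ * g⁻¹ ∈ unitaryGroup σ H' := by
  rw [← twistGram_coe_eq_iff_mem_unitaryGroup, Units.val_mul, Units.val_mul, twistGram_mul, twistGram_mul_eq_of_twistGram_eq_mul₂ σ H H' hγ hx hgx,
    ← twistGram_mul, ← Units.val_mul, mul_inv_cancel, Units.val_one, twistGram_one]

/-- The realised element packaged in `U(H′)(R)`: `∃ δ ∈ U(H′)(R)`, `g γ g⁻¹ = δ` (so `γ` and `δ` are `GL_n(R)`-conjugate: `IsConj`).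
[cite: Rogawski1990, §3.1 p. 19; §14.1 p. 232] -/
theorem exists_unitary_isConj_of_twistGram_eq_mul₂ {γ : GL n R} (hγ : γ ∈ unitaryGroup σ H) {x : Matrix n n R} (hx : Commute x (γ : Matrix n n R))
    {g : GL n R} (hgx : twistGram σ H' (g : Matrix n n R) = H * x) :
    ∃ δ : unitaryGroup σ H', g * γ * g⁻¹ = (δ : GL n R) ∧ IsConj γ (δ : GL n R) :=
  ⟨⟨g * γ * g⁻¹, conj_mem_unitaryGroup_of_twistGram_eq_mul₂ σ H H' hγ hx hgx⟩, rfl, isConj_iff.mpr ⟨g, rfl⟩⟩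

end General

/-! ## §2 (ED. 2) Conversely: a conjugator INTO `U(H′)` transports `H′` to a `γ`-invariant form `H · x`, `x ∈ Z(γ)` ⋆-symmetric -/

section Converse

variable {R : Type*} [CommRing R] {n : Type*} [Fintype n] [DecidableEq n] (σ : R →+* R) (H H' : Matrix n n R)

/-- `g γ = δ g` as matrices (plumbing). [cite: Rogawski1990, §3.1 p. 19] -/
private theorem coe_mul_eq_of_conj_eq₂ {γ δ g : GL n R} (hg : g * γ * g⁻¹ = δ) :
    (g : Matrix n n R) * (γ : Matrix n n R) = (δ : Matrix n n R) * (g : Matrix n n R) := by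
  have h : g * γ = δ * g := by rw [← hg, inv_mul_cancel_right]
  simpa only [Units.val_mul] using congrArg (fun x : GL n R => (x : Matrix n n R)) h

/-- **`H′_g` is `γ`-invariant when `g γ g⁻¹ ∈ U(H′)(R)`**: `ᵗ(σγ) H′_g γ = H′_{gγ} = H′_{δg} = H′_g`. [cite: Rogawski1990, §3.1 p. 19; §14.1 p. 232] -/
theorem twistGram_invariant₂ {γ : GL n R} {δ : unitaryGroup σ H'} {g : GL n R} (hg : g * γ * g⁻¹ = (δ : GL n R)) :
    ((γ : Matrix n n R).map σ)ᵀ * twistGram σ H' (g : Matrix n n R) * (γ : Matrix n n R) = twistGram σ H' (g : Matrix n n R) := by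
  rw [← twistGram_mul, coe_mul_eq_of_conj_eq₂ hg, twistGram_unitary_mul σ H' δ.2]

/-- **`x := H⁻¹ H′_g` commutes with `γ ∈ U(H)(R)` when `g γ g⁻¹ ∈ U(H′)(R)`** — the two-form twin of ★ `commute_inv_mul_twistGram`: the transported form
`H′_g` is `H · x` with `x` in the Cartan algebra `Z(γ)` (for `H` invertible). [cite: Rogawski1990, §3.1 p. 19; §3.5 p. 29; §14.1 p. 232] -/
theorem commute_inv_mul_twistGram₂ (hH : IsUnit H.det) {γ : unitaryGroup σ H} {δ : unitaryGroup σ H'} {g : GL n R}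
    (hg : g * (γ : GL n R) * g⁻¹ = (δ : GL n R)) :
    Commute (H⁻¹ * twistGram σ H' (g : Matrix n n R)) ((γ : GL n R) : Matrix n n R) := by
  set T := twistGram σ H' (g : Matrix n n R) with hT
  set c : Matrix n n R := ((γ : GL n R) : Matrix n n R) with hc
  have hγ : (c.map σ)ᵀ * H * c = H := mem_unitaryGroup_iff.mp γ.2
  have hTγ : (c.map σ)ᵀ * T * c = T := twistGram_invariant₂ σ H' hg
  have hcinv : c * (((γ : GL n R)⁻¹ : GL n R) : Matrix n n R) = 1 := by
    rw [hc, ← Units.val_mul, mul_inv_cancel, Units.val_one]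
  have hHinv : H * H⁻¹ = 1 := Matrix.mul_nonsing_inv H hH
  have hHinv' : H⁻¹ * H = 1 := Matrix.nonsing_inv_mul H hH
  have hσγ : (c.map σ)ᵀ = H * (((γ : GL n R)⁻¹ : GL n R) : Matrix n n R) * H⁻¹ := by
    calc (c.map σ)ᵀ = (c.map σ)ᵀ * H * c * ((((γ : GL n R)⁻¹ : GL n R) : Matrix n n R) * H⁻¹) := by
          rw [Matrix.mul_assoc ((c.map σ)ᵀ * H), ← Matrix.mul_assoc c, hcinv, Matrix.one_mul, Matrix.mul_assoc, hHinv,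
            Matrix.mul_one]
      _ = H * (((γ : GL n R)⁻¹ : GL n R) : Matrix n n R) * H⁻¹ := by rw [hγ, Matrix.mul_assoc]
  have key : H⁻¹ * T = (((γ : GL n R)⁻¹ : GL n R) : Matrix n n R) * (H⁻¹ * T) * c := by
    calc H⁻¹ * T = H⁻¹ * ((c.map σ)ᵀ * T * c) := by rw [hTγ]
      _ = H⁻¹ * (H * (((γ : GL n R)⁻¹ : GL n R) : Matrix n n R) * H⁻¹ * T * c) := by rw [hσγ]
      _ = (H⁻¹ * H) * (((γ : GL n R)⁻¹ : GL n R) : Matrix n n R) * H⁻¹ * T * c := by simp only [Matrix.mul_assoc]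
      _ = (((γ : GL n R)⁻¹ : GL n R) : Matrix n n R) * (H⁻¹ * T) * c := by rw [hHinv', Matrix.one_mul]; simp only [Matrix.mul_assoc]
  show H⁻¹ * T * c = c * (H⁻¹ * T)
  conv_rhs => rw [key]
  rw [← Matrix.mul_assoc, ← Matrix.mul_assoc, hcinv, Matrix.one_mul]

/-- … so `x := H⁻¹ H′_g ∈ Z(γ)` (★ `cartanAlgebra`). [cite: Rogawski1990, §3.1 p. 19; §3.5 p. 29] -/
theorem inv_mul_twistGram_mem_cartanAlgebra₂ (hH : IsUnit H.det) {γ : unitaryGroup σ H} {δ : unitaryGroup σ H'} {g : GL n R}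
    (hg : g * (γ : GL n R) * g⁻¹ = (δ : GL n R)) :
    H⁻¹ * twistGram σ H' (g : Matrix n n R) ∈ cartanAlgebra (((γ : GL n R) : Matrix n n R)) :=
  mem_cartanAlgebra_iff.mpr (commute_inv_mul_twistGram₂ σ H H' hH hg)

/-- … and `H′_g = H · x` with that `x`. [cite: Rogawski1990, §3.1 p. 19] -/
theorem twistGram_eq_mul_inv_mul_twistGram (hH : IsUnit H.det) (g : Matrix n n R) :
    twistGram σ H' g = H * (H⁻¹ * twistGram σ H' g) := by
  rw [← Matrix.mul_assoc, Matrix.mul_nonsing_inv H hH, Matrix.one_mul]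


end Converse

end Literature.NumberTheory.Rogawski1990

end
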